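import Literature.MathematicalPhysics.QuantumFieldTheory.Balaban1983to89.T4ShellMeasureDet
import Summits.QuantumFields.YangMills.Theorems.BalabanUVNodesN21DilationTransversal
import Mathlib.MeasureTheory.Measure.Lebesgue.EqHaar

/-!
# N21 (NE7c) · the RE-CENTRED (shear) block dilation on `X × (κ → ℝ)`: Haar bookkeeping and the transport of (M1)
# (lens Card 78 ∕ ROW P, first half)

R134 seat pub-ymgap-dag-n21-d (g8), node N21 = NE7c (single-run shell-weight bound, NOT PRINTED in [Bałaban 1983–89],
NOT proved), lane K3⁷ `SpineGivenEndpointR13SepCoPH` (stmt-QuantumFields-20544, `--kind proof --supports … --as helper`).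
Part 27 of the comparison series.  THIS FILE = §C of the lens's `Sketch-nearmiss-g27.lean` (LENS-nearmiss v27.0 ROW P; first refusal
dag-n21-d) (farm rc 0 · 0 warnings at the lens desk) VERBATIM — statements and proofs — re-homed in this namespace.  AUTHORSHIP OF THE
MATHEMATICS: planner seat `ym-lens-BalabanUVNodes-nearmiss` g27 (memo-only seat, cannot file); this seat only files.  §E of the same
sketch (ROW P proper: P1∕P2) lands as part 28 `…N21RecentredDilationTransversal`, §A+§B+§D as part 29
`…N21ConstrainedMinNonCollapse` (400-line rule).

WHAT (lens Card 78).  Parts 18∕19 dilate about the chart centre; for a block coupled to its exterior the non-collapse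
binder is false there (toy, part 29 §A) and true about the exterior-pinned minimiser (convexity, part 29 §B).  On
`X × (κ → ℝ)` = (exterior point, ANY s-finite law `ζ`) × (block chart, Lebesgue), the shear to centred coordinates
`(z, v) ↦ (z, m z + v)` PRESERVES `ζ ⊗ vol` for any measurable centre `m`; the re-centred dilation
`R_l (z, w) = (z, m z + l • (w − m z))` maps `ζ ⊗ vol` to `|l^{#κ}|⁻¹ • (ζ ⊗ vol)`; (M1) is transported along the
shear (`T4ShellMeasureDet.slotAntiConcentration_withDensity_map` BY NAME); the one-parameter change of variables under
block non-collapse holds in this product frame for ANY density.  Print integrates in these coordinates ([CMP 109 (2.3)]).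

HONEST FRAMING.  [textbook] measure theory ∕ convexity over the tree's typed (M1) frame (cited by name); every located input stays a
HYPOTHESIS; 0 def, 0 sorry; nothing of Bałaban's asserted; NE7c NOT PRINTED ∕ NOT proved; N21 NOT discharged; counts
unmoved (typed 28∕28 · discharged 5∕27); count-neutral; one finite 𝕋⁴ at fixed ε — nothing about ℝ⁴ ∕ OS ∕ mass gap ∕ Clay.
-/

open MeasureTheory Set Function Module
open scoped ENNReal
open Literature.MathematicalPhysics.QuantumFieldTheory.Balaban1983to89
open Literature.MathematicalPhysics.QuantumFieldTheory.Balaban1983to89.T4ShellMeasure (SlotAntiConcentration)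
open Literature.MathematicalPhysics.QuantumFieldTheory.Balaban1983to89.T4ShellMeasureDet
  (slotAntiConcentration_withDensity_map)

namespace Summit.QuantumFields.YangMills.Theorems.N21RecentredDilation

/-! ## §C  The re-centred block dilation on `X × (κ → ℝ)`: Haar bookkeeping and the transport of (M1) -/

section Recentre

variable {X : Type*} [MeasurableSpace X] {κ : Type*} [Fintype κ]

omit [Fintype κ] in
/-- the shear to centred coordinates is measurable. [textbook] -/
theorem measurable_shearRecentre {m : X → (κ → ℝ)} (hm : Measurable m) :
    Measurable fun p : X × (κ → ℝ) => (p.1, m p.1 + p.2) :=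
  measurable_fst.prodMk ((hm.comp measurable_fst).add measurable_snd)

omit [Fintype κ] in
/-- the re-centred block dilation is measurable. [textbook] -/
theorem measurable_shearRecentredDil {m : X → (κ → ℝ)} (hm : Measurable m) (l : ℝ) :
    Measurable fun p : X × (κ → ℝ) => (p.1, m p.1 + l • (p.2 - m p.1)) :=
  measurable_fst.prodMk ((hm.comp measurable_fst).add ((measurable_snd.sub (hm.comp measurable_fst)).const_smul l))

/-- **THE SHEAR TO CENTRED COORDINATES PRESERVES THE LAW** `ζ ⊗ Lebesgue` — translation invariance of Lebesgue
measure on the block chart, fibre by fibre over the exterior point (Mathlib `MeasurePreserving.skew_product`,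
`map_add_left_eq_self`).  [textbook] -/
theorem measurePreserving_shearRecentre (ζ : Measure X) [SFinite ζ] {m : X → (κ → ℝ)} (hm : Measurable m) :
    MeasurePreserving (fun p : X × (κ → ℝ) => (p.1, m p.1 + p.2)) (ζ.prod volume) (ζ.prod volume) :=
  (MeasurePreserving.id ζ).skew_product (g := fun z v => m z + v)
    ((hm.comp measurable_fst).add measurable_snd)
    (Filter.Eventually.of_forall fun z => map_add_left_eq_self volume (m z))

/-- **HAAR UNDER THE FIXED-CENTRE BLOCK DILATION ON THE PRODUCT**: `map (z, w) ↦ (z, l • w)` sends `ζ ⊗ vol` to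
`|l^{#κ}|⁻¹ • (ζ ⊗ vol)` (`l ≠ 0`) — part 18's `map_volume_partialDil` with an arbitrary exterior law. [textbook] -/
theorem map_blockDil (ζ : Measure X) [SFinite ζ] {l : ℝ} (hl : l ≠ 0) :
    Measure.map (fun p : X × (κ → ℝ) => (p.1, l • p.2)) (ζ.prod volume)
      = ENNReal.ofReal |(l ^ Fintype.card κ)⁻¹| • ζ.prod volume := by
  have h := (MeasurePreserving.id ζ).skew_product (μc := (volume : Measure (κ → ℝ)))
    (g := fun _ w => l • w) (measurable_snd.const_smul l)
    (Filter.Eventually.of_forall fun _ => Measure.map_addHaar_smul volume hl)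
  rw [finrank_fintype_fun_eq_card, Measure.prod_smul_right] at h
  exact h.map_eq

/-- **HAAR UNDER THE RE-CENTRED BLOCK DILATION**: `map R_l (ζ ⊗ vol) = |l^{#κ}|⁻¹ • (ζ ⊗ vol)` for
`R_l (z, w) = (z, m z + l • (w − m z))`, ANY measurable centre `m` (`l ≠ 0`): on each fibre `R_l` is the dilation by
`l` followed by the translation by `(1−l)·m z`. [textbook] -/
theorem map_recentredDil (ζ : Measure X) [SFinite ζ] {m : X → (κ → ℝ)} (hm : Measurable m) {l : ℝ}
    (hl : l ≠ 0) :
    Measure.map (fun p : X × (κ → ℝ) => (p.1, m p.1 + l • (p.2 - m p.1))) (ζ.prod volume)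
      = ENNReal.ofReal |(l ^ Fintype.card κ)⁻¹| • ζ.prod volume := by
  have hfib : ∀ z : X, Measure.map (fun w : κ → ℝ => m z + l • (w - m z)) volume
      = ENNReal.ofReal |(l ^ Fintype.card κ)⁻¹| • (volume : Measure (κ → ℝ)) := by
    intro z
    have hcomp : (fun w : κ → ℝ => m z + l • (w - m z))
        = (fun v : κ → ℝ => (m z - l • m z) + v) ∘ (fun w : κ → ℝ => l • w) := by
      funext w
      simp only [comp_apply, smul_sub]
      abel
    rw [hcomp, ← Measure.map_map (measurable_const_add _) (measurable_const_smul l),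
      Measure.map_addHaar_smul volume hl, Measure.map_smul, map_add_left_eq_self,
      finrank_fintype_fun_eq_card]
  have h := (MeasurePreserving.id ζ).skew_product (μc := (volume : Measure (κ → ℝ)))
    (g := fun z w => m z + l • (w - m z))
    ((hm.comp measurable_fst).add ((measurable_snd.sub (hm.comp measurable_fst)).const_smul l))
    (Filter.Eventually.of_forall hfib)
  rw [Measure.prod_smul_right] at h
  exact h.map_eq

omit [MeasurableSpace X] [Fintype κ] in
/-- the re-centred dilation IS the fixed-centre block dilation CONJUGATED by the shear:
`R_l = (shear by m) ∘ (z, v) ↦ (z, l • v) ∘ (shear by −m)`. [textbook] -/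
theorem recentredDil_eq_conj (m : X → (κ → ℝ)) (l : ℝ) :
    (fun p : X × (κ → ℝ) => (p.1, m p.1 + l • (p.2 - m p.1)))
      = (fun p : X × (κ → ℝ) => (p.1, m p.1 + p.2)) ∘ (fun p : X × (κ → ℝ) => (p.1, l • p.2))
          ∘ (fun p : X × (κ → ℝ) => (p.1, p.2 - m p.1)) := by
  funext p
  simp only [comp_apply]

/-- a restricted tilted law is the law tilted by the cut density (Mathlib `restrict_withDensity`,
`withDensity_indicator`). [textbook] -/
theorem restrict_withDensity_eq_indicator {Ω : Type*} [MeasurableSpace Ω] (μ : Measure Ω) {S : Set Ω}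
    (hS : MeasurableSet S) (G : Ω → ℝ≥0∞) : (μ.withDensity G).restrict S = μ.withDensity (S.indicator G) := by
  rw [withDensity_indicator hS, restrict_withDensity hS]

/-- **(M1) TRANSPORTS TO CENTRED COORDINATES.**  `ν = (ζ ⊗ vol).withDensity G` on `X × (κ → ℝ)` (`G` ANY measurable
density: action, Jacobian, gauge-fixing density, all cuts), `U` measurable.  If (M1) holds for the PULLED-BACK data
`G ∘ shear`, `U ∘ shear` (centre moved to `0` on every fibre), it holds for `ν, U` — same `θ, ρ, D`
(`T4ShellMeasureDet.slotAntiConcentration_withDensity_map` BY NAME ∘ `measurePreserving_shearRecentre`). [textbook] -/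
theorem slotAC_of_recentred (ζ : Measure X) [SFinite ζ] {m : X → (κ → ℝ)} (hm : Measurable m)
    {G : X × (κ → ℝ) → ℝ≥0∞} (hG : Measurable G) {U : X × (κ → ℝ) → ℝ} (hU : Measurable U) {θ ρ D : ℝ}
    (h : SlotAntiConcentration ((ζ.prod volume).withDensity fun p => G (p.1, m p.1 + p.2))
      (fun p => U (p.1, m p.1 + p.2)) θ ρ D) :
    SlotAntiConcentration ((ζ.prod volume).withDensity G) U θ ρ D :=
  slotAntiConcentration_withDensity_map (measurePreserving_shearRecentre ζ hm) hG hU h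

/-- **(M1) FOR A CUT LAW TRANSPORTS TO CENTRED COORDINATES** (the shape of parts 18/19's conclusions
`SlotAntiConcentration (ν|({U<θ} ∩ C)) U θ ρ D`): the cut `S` pulls back to `shear ⁻¹' S`. [textbook] -/
theorem slotAC_restrict_of_recentred (ζ : Measure X) [SFinite ζ] {m : X → (κ → ℝ)} (hm : Measurable m)
    {G : X × (κ → ℝ) → ℝ≥0∞} (hG : Measurable G) {U : X × (κ → ℝ) → ℝ} (hU : Measurable U)
    {S : Set (X × (κ → ℝ))} (hS : MeasurableSet S) {θ ρ D : ℝ}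
    (h : SlotAntiConcentration
      (((ζ.prod volume).withDensity fun p => G (p.1, m p.1 + p.2)).restrict
        ((fun p : X × (κ → ℝ) => (p.1, m p.1 + p.2)) ⁻¹' S))
      (fun p => U (p.1, m p.1 + p.2)) θ ρ D) :
    SlotAntiConcentration (((ζ.prod volume).withDensity G).restrict S) U θ ρ D := by
  have key : (fun p : X × (κ → ℝ) => S.indicator G (p.1, m p.1 + p.2))
      = ((fun p : X × (κ → ℝ) => (p.1, m p.1 + p.2)) ⁻¹' S).indicator (fun p => G (p.1, m p.1 + p.2)) := by
    funext p
    rfl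
  rw [restrict_withDensity_eq_indicator _ hS]
  rw [restrict_withDensity_eq_indicator _ (measurable_shearRecentre hm hS), ← key] at h
  exact slotAntiConcentration_withDensity_map (measurePreserving_shearRecentre ζ hm) (hG.indicator hS) hU h

/-- **ONE-PARAMETER CHANGE OF VARIABLES UNDER BLOCK NON-COLLAPSE, ANY DENSITY, PRODUCT FRAME** (part 16's
`setLIntegral_le_pow_mul_setLIntegral_smul` ∕ part 18's `setLIntegral_shell_le_of_blockNonCollapse` on
`X × (κ → ℝ)`): `g` measurable with `g p ≤ g (z, l • w)` on a measurable `S` (`l > 0`) ⇒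
`∫_S g ≤ l^{−#κ} · ∫_{D_l S} g`, `D_l S = {q : (q.1, l⁻¹ • q.2) ∈ S}`.  In centred coordinates this is the step
the re-centred END iterates over `l`. [textbook] -/
theorem setLIntegral_le_pow_mul_of_blockNonCollapse (ζ : Measure X) [SFinite ζ] {g : X × (κ → ℝ) → ℝ≥0∞}
    (hg : Measurable g) {S : Set (X × (κ → ℝ))} (hS : MeasurableSet S) {l : ℝ} (hl : 0 < l)
    (hmono : ∀ p ∈ S, g p ≤ g (p.1, l • p.2)) :
    ∫⁻ p in S, g p ∂(ζ.prod volume)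
      ≤ ENNReal.ofReal ((l ^ Fintype.card κ)⁻¹)
        * ∫⁻ q in (fun q : X × (κ → ℝ) => (q.1, l⁻¹ • q.2)) ⁻¹' S, g q ∂(ζ.prod volume) := by
  set Sl : Set (X × (κ → ℝ)) := (fun q : X × (κ → ℝ) => (q.1, l⁻¹ • q.2)) ⁻¹' S with hSl
  have hDm : Measurable (fun q : X × (κ → ℝ) => (q.1, l • q.2)) :=
    measurable_fst.prodMk (measurable_snd.const_smul l)
  have hDm' : Measurable (fun q : X × (κ → ℝ) => (q.1, l⁻¹ • q.2)) :=
    measurable_fst.prodMk (measurable_snd.const_smul l⁻¹)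
  have hSlm : MeasurableSet Sl := hDm' hS
  have h1 : ∫⁻ p in S, g p ∂(ζ.prod volume) ≤ ∫⁻ p in S, g (p.1, l • p.2) ∂(ζ.prod volume) :=
    setLIntegral_mono' hS fun p hp => hmono p hp
  refine h1.trans ?_
  have hmem : ∀ p : X × (κ → ℝ), (p.1, l • p.2) ∈ Sl ↔ p ∈ S := by
    intro p
    simp only [hSl, mem_preimage, inv_smul_smul₀ hl.ne', Prod.mk.eta]
  have hind : ∀ p : X × (κ → ℝ),
      S.indicator (fun p : X × (κ → ℝ) => g (p.1, l • p.2)) p = Sl.indicator g (p.1, l • p.2) := by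
    intro p
    by_cases hp : p ∈ S
    · rw [indicator_of_mem hp, indicator_of_mem ((hmem p).2 hp)]
    · rw [indicator_of_notMem hp, indicator_of_notMem fun h => hp ((hmem p).1 h)]
  rw [← lintegral_indicator hS, ← lintegral_indicator hSlm]
  simp_rw [hind]
  rw [← lintegral_map (hg.indicator hSlm) hDm, map_blockDil ζ hl.ne', lintegral_smul_measure,
    abs_of_nonneg (inv_nonneg.2 (pow_nonneg hl.le _)), smul_eq_mul]

end Recentre

end Summit.QuantumFields.YangMills.Theorems.N21RecentredDilation
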